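import Mathlib
import Summits.Ventures.PercRepro.PuncturedLYMCapGuard

/-!
# PercRepro — THE VALUE-BLOCK PIPELINE, UNIFORMLY IN `(n, k)`: (SP) FOR EVERY MATCHING CODE
(p10, gen 42)

The first certificate uniform in `(n, k)` produced by the pipeline: `k` pairwise disjoint PAIRS at level `2` on `n = 2k + f`
points.  The only stage with removal probabilities is the cap-`1` stage: `β(1) = N1/D1` (`f ≥ 2`), `β(2) = num2/den2`
(`f ≥ 2`), `(4k+1)/(6k)` (`f = 1`), `β(3) = 1` (the all-block column), where `D1 = 6k·P`, `den2 = D1·(k − 1)`, `P = #P`,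
and the leaf identities are the count identities of the three row classes.  The positivity of the four numerators and of
the denominators is the nonnegativity of their coefficients after the shift `k = 1 + k'`, `f = 2 + f'` (`positivity`), the
leaf identities are `field_simp; ring`.  `puncturedNMP_matching`: (SP) for every matching code (the tree's
PuncturedLYMMatching re-proved by the pipeline).  Nothing here asserts (SP).
-/

namespace PercRepro.PuncturedLYM.Split.Peel.Matching

open Finset PercRepro.PuncturedLYM.Split.Peel

/-- `n = 2K + f`. -/
def nq (K f : ℚ) : ℚ := 2 * K + f
/-- `#P = C(n, 2) − K`. -/
def Pq (K f : ℚ) : ℚ := nq K f * (nq K f - 1) / 2 - K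
/-- `#Y = C(n, 3)`. -/
def Yq (K f : ℚ) : ℚ := nq K f * (nq K f - 1) * (nq K f - 2) / 6
/-- The numerator of `β(1)`: `3·#Y − (f − 2)·#P`. -/
def N1 (K f : ℚ) : ℚ := f ^ 2 * K + 4 * f * K ^ 2 + 4 * K ^ 3 - 2 * K ^ 2 - 2 * K
/-- The denominator of `β(1)`: `6K·#P`. -/
def D1 (K f : ℚ) : ℚ := 3 * f ^ 2 * K + 12 * f * K ^ 2 + 12 * K ^ 3 - 3 * f * K - 12 * K ^ 2
/-- The numerator of `β(2)` for `f ≥ 2`. -/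
def num2 (K f : ℚ) : ℚ :=
  2 * f ^ 2 * K ^ 2 + 8 * f * K ^ 3 + 8 * K ^ 4 - 2 * f ^ 2 * K - 9 * f * K ^ 2 - 14 * K ^ 3 + f * K + 5 * K ^ 2 + K
/-- The denominator of `β(2)` for `f ≥ 2`: `D1·(K − 1)`. -/
def den2 (K f : ℚ) : ℚ :=
  3 * f ^ 2 * K ^ 2 + 12 * f * K ^ 3 + 12 * K ^ 4 - 3 * f ^ 2 * K - 15 * f * K ^ 2 - 24 * K ^ 3 + 3 * f * K + 12 * K ^ 2

/-- The β-table of the pattern (pairs at level 2): only the cap-`1` stage. -/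
def tab : ℕ → ℕ → ℕ → ℕ → ℚ → ℚ → ℕ → ℚ := fun K f _ _ _ _ c =>
  if c = 1 then (if 2 ≤ f then N1 K f / D1 K f else 0)
  else if c = 2 then (if 2 ≤ f then num2 K f / den2 K f else if f = 1 then (4 * (K : ℚ) + 1) / (6 * K) else 0)
  else if c = 3 then 1 else 0

/-! ### Positivity by the shift `K = 1 + k'`, `f = 2 + f'` -/

/-- `β(1) ≥ 0`: the numerator is nonnegative for `K ≥ 1`, `f ≥ 2`. -/
theorem N1_nonneg {K f : ℕ} (hK : 1 ≤ K) (hf : 2 ≤ f) : 0 ≤ N1 K f := by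
  obtain ⟨k', rfl⟩ := Nat.exists_eq_add_of_le hK
  obtain ⟨f', rfl⟩ := Nat.exists_eq_add_of_le hf
  simp only [N1]; push_cast; ring_nf; positivity

/-- The denominator `6K·#P` is positive for `K ≥ 1`, `f ≥ 2`. -/
theorem D1_pos {K f : ℕ} (hK : 1 ≤ K) (hf : 2 ≤ f) : 0 < D1 K f := by
  obtain ⟨k', rfl⟩ := Nat.exists_eq_add_of_le hK
  obtain ⟨f', rfl⟩ := Nat.exists_eq_add_of_le hf
  simp only [D1]; push_cast; ring_nf; positivity

/-- `β(1) ≤ 1`. -/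
theorem N1_le_D1 {K f : ℕ} (hK : 1 ≤ K) (hf : 2 ≤ f) : N1 K f ≤ D1 K f := by
  obtain ⟨k', rfl⟩ := Nat.exists_eq_add_of_le hK
  obtain ⟨f', rfl⟩ := Nat.exists_eq_add_of_le hf
  rw [← sub_nonneg]
  simp only [N1, D1]; push_cast; ring_nf; positivity

/-- `β(2) ≥ 0` (`f ≥ 2`). -/
theorem num2_nonneg {K f : ℕ} (hK : 1 ≤ K) (hf : 2 ≤ f) : 0 ≤ num2 K f := by
  obtain ⟨k', rfl⟩ := Nat.exists_eq_add_of_le hK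
  obtain ⟨f', rfl⟩ := Nat.exists_eq_add_of_le hf
  simp only [num2]; push_cast; ring_nf; positivity

/-- The denominator `D1·(K − 1)` is positive for `K ≥ 2`, `f ≥ 2`. -/
theorem den2_pos {K f : ℕ} (hK : 2 ≤ K) (hf : 2 ≤ f) : 0 < den2 K f := by
  obtain ⟨k', rfl⟩ := Nat.exists_eq_add_of_le hK
  obtain ⟨f', rfl⟩ := Nat.exists_eq_add_of_le hf
  simp only [den2]; push_cast; ring_nf; positivity

/-- `β(2) ≤ 1` (`f ≥ 2`). -/
theorem num2_le_den2 {K f : ℕ} (hK : 1 ≤ K) (hf : 2 ≤ f) : num2 K f ≤ den2 K f := by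
  obtain ⟨k', rfl⟩ := Nat.exists_eq_add_of_le hK
  obtain ⟨f', rfl⟩ := Nat.exists_eq_add_of_le hf
  rw [← sub_nonneg]
  simp only [num2, den2]; push_cast; ring_nf; positivity

/-- `#P > 0` when there are at least two free points. -/
theorem Pq_pos_of_free {K f : ℕ} (hf : 2 ≤ f) : 0 < Pq K f := by
  obtain ⟨f', rfl⟩ := Nat.exists_eq_add_of_le hf
  simp only [Pq, nq]; push_cast; ring_nf; positivity

/-- `#P > 0` when there are at least two members. -/
theorem Pq_pos_of_two {K f : ℕ} (hK : 2 ≤ K) : 0 < Pq K f := by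
  obtain ⟨k', rfl⟩ := Nat.exists_eq_add_of_le hK
  simp only [Pq, nq]; push_cast; ring_nf; positivity

/-- `#P > 0` with one member and one free point. -/
theorem Pq_pos_of_one {K f : ℕ} (hK : 1 ≤ K) (hf : 1 ≤ f) : 0 < Pq K f := by
  obtain ⟨k', rfl⟩ := Nat.exists_eq_add_of_le hK
  obtain ⟨f', rfl⟩ := Nat.exists_eq_add_of_le hf
  simp only [Pq, nq]; push_cast; ring_nf; positivity

/-- The table lies in `[0, 1]`. -/
theorem tab_mem {K f l w : ℕ} {a γ : ℚ} (c : ℕ) : 0 ≤ tab K f l w a γ c ∧ tab K f l w a γ c ≤ 1 := by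
  simp only [tab]
  split_ifs with h1 hf h2 hf' hf1 h3
  · -- `c = 1`, `f ≥ 2`
    rcases Nat.eq_zero_or_pos K with hK | hK
    · subst hK; simp [D1]
    · exact ⟨div_nonneg (N1_nonneg hK hf) (D1_pos hK hf).le,
        (div_le_one (D1_pos hK hf)).2 (N1_le_D1 hK hf)⟩
  · exact ⟨le_refl 0, zero_le_one⟩
  · -- `c = 2`, `f ≥ 2`
    rcases Nat.lt_or_ge K 2 with hK | hK
    · have : den2 K f = 0 := by
        interval_cases K <;> (simp only [den2]; push_cast; ring)
      rw [this, div_zero]; exact ⟨le_refl 0, zero_le_one⟩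
    · exact ⟨div_nonneg (num2_nonneg (by omega) hf') (den2_pos hK hf').le,
        (div_le_one (den2_pos hK hf')).2 (num2_le_den2 (by omega) hf')⟩
  · -- `c = 2`, `f = 1`
    rcases Nat.eq_zero_or_pos K with hK | hK
    · subst hK; norm_num
    · have hKq : (0 : ℚ) < K := by exact_mod_cast hK
      refine ⟨div_nonneg (by positivity) (by positivity), (div_le_one (by positivity)).2 ?_⟩
      have : (1 : ℚ) ≤ K := by exact_mod_cast hK
      linarith
  · exact ⟨le_refl 0, zero_le_one⟩
  · exact ⟨zero_le_one, le_refl 1⟩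
  · exact ⟨le_refl 0, zero_le_one⟩

/-- **The table is admissible for every `(K, f)`.** -/
theorem countOKg_tab (K f : ℕ) :
    CountOKg 2 tab 1 K f 2 1 (1 / (2 : ℚ)) (Yq K f / Pq K f) := by
  simp only [CountOKg]
  refine ⟨rfl, fun c => tab_mem c, ?_, ?_⟩
  · intro c hc
    have : c = 3 := by omega
    subst this
    simp [tab]
  · intro c hcK hc _ hguard
    simp only [zero_add, one_mul] at hguard hc ⊢
    interval_cases c
    · -- the class `c = 0`: `R = (f − 2)/3 + 2K·β(1)`
      have hf : 2 ≤ f := by simpa using hguard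
      have hP' := (Pq_pos_of_free (K := K) hf).ne'
      simp only [tab]
      norm_num
      rw [if_pos hf, Nat.cast_sub hf]
      rcases Nat.eq_zero_or_pos K with hK | hK
      · subst hK
        norm_num
        push_cast at hP'
        field_simp
        simp only [Yq, Pq, nq]; ring
      · have hD' := (D1_pos hK hf).ne'
        field_simp
        simp only [Yq, Pq, nq, N1, D1]; push_cast; ring
    · -- the class `c = 1`: `R − 1/2 = (1 − β(1))(f − 1)/2 + β(2)(K − 1)`
      have hf1 : 1 ≤ f := by simpa using hguard
      have hK : 1 ≤ K := hcK
      have hP' := (Pq_pos_of_one hK hf1).ne'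
      simp only [tab]
      norm_num
      rw [Nat.cast_sub hf1, Nat.cast_sub hK]
      rcases Nat.lt_or_ge f 2 with hf | hf
      · have hf1' : f = 1 := by omega
        subst hf1'
        rw [if_neg (by norm_num), if_neg (by norm_num), if_pos rfl]
        rcases Nat.lt_or_ge K 2 with hK2 | hK2
        · have hK1 : K = 1 := by omega
          subst hK1
          norm_num
          push_cast at hP'
          field_simp
          simp only [Yq, Pq, nq]; ring
        · have hKq : (K : ℚ) ≠ 0 := by positivity
          have h6 : (6 * (K : ℚ)) ≠ 0 := by positivity
          simp only [Yq, Pq, nq]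
          push_cast
          have hPq : (2 * (K : ℚ) + 1) * (2 * K + 1 - 1) / 2 - K = 2 * K ^ 2 := by ring
          rw [hPq]
          field_simp
          ring
      · have hD' := (D1_pos hK hf).ne'
        rw [if_pos hf, if_pos hf]
        rcases Nat.lt_or_ge K 2 with hK2 | hK2
        · have hK1 : K = 1 := by omega
          subst hK1
          norm_num
          push_cast at hP' hD'
          field_simp
          simp only [Yq, Pq, nq, N1, D1]; ring
        · have hd' := (den2_pos hK2 hf).ne'
          field_simp
          simp only [Yq, Pq, nq, N1, D1, num2, den2]; push_cast; ring
    · -- the class `c = 2`: `R − 1 = (1 − β(2))·f + (2/3)(K − 2)`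
      have hK : 2 ≤ K := hcK
      have hP' := (Pq_pos_of_two (f := f) hK).ne'
      simp only [tab]
      norm_num
      rw [Nat.cast_sub hK]
      rcases Nat.lt_or_ge f 2 with hf | hf
      · rcases Nat.lt_or_ge f 1 with hf0 | hf1
        · have : f = 0 := by omega
          subst this
          norm_num
          push_cast at hP'
          field_simp
          simp only [Yq, Pq, nq]; ring
        · have : f = 1 := by omega
          subst this
          norm_num
          have hKq : (K : ℚ) ≠ 0 := by positivity
          push_cast at hP'
          field_simp
          simp only [Yq, Pq, nq]; ring
      · have hd' := (den2_pos hK hf).ne'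
        rw [if_pos hf]
        field_simp
        simp only [Yq, Pq, nq, num2, den2]; push_cast; ring

/-- **(SP) FOR EVERY MATCHING CODE, BY THE VALUE-BLOCK PIPELINE.** -/
theorem puncturedNMP_matching {α : Type} [Fintype α] [DecidableEq α] {k : ℕ} (C : Fin k → Finset α)
    (hcard : ∀ i, (C i).card = 2) (hdisj : ∀ i j, i ≠ j → Disjoint (C i) (C j)) :
    PuncturedNMP 2 ((univ : Finset (Fin k)).biUnion (fun i => upLevel 2 (C i))) :=
  puncturedNMP_of_countOKg tab C (by norm_num) hcard hdisj (by norm_num)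
    (countOKg_tab k (Fintype.card α - 2 * k))

end PercRepro.PuncturedLYM.Split.Peel.Matching
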